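import Literature.AlgebraicGeometry.Frobenioids.ArithmeticFrobenioidThm64iVariants
import Literature.AlgebraicGeometry.Frobenioids.PadicFrobenioidStandardType
import HarnessLib

/-!
# Frobenioids I, Definition 1.1 (i)/(ii): non-dilating endomorphisms AT THE GENUINE INSTANCES
# (D-0079 L-F [FrdI/II], pack D: FACT rows F-1227 `PreFrobenioidData.IsNonDilating` and F-1073
# `Frobenioids.IsNonDilating` — instance forms with the FACT declaration as conclusion head)

Mochizuki, *The geometry of Frobenioids I: the general theory*, Kyushu J. Math. **62** (2008) 293–400, §1,
Definition 1.1 (i)–(ii), kurims p. 19 (line numbers of the cell's render, running head = l. 1), verbatim: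
(i) ll. 17–20 «If α is an endomorphism of a pre-divisorial monoid M ∈ Ob(Mon), then we shall say that α is
non-dilating if the endomorphism α^char of M^char induced by α is the identity endomorphism of M^char whenever
α^char(a) ≼ a for all primary [cf. §0] a ∈ M^char.» and (ii) ll. 32–34 «If Φ is pre-divisorial, then we shall say
that Φ is non-dilating if the endomorphisms of Φ(A), where A ∈ Ob(D), induced by endomorphisms ∈ End_D(A) are
non-dilating.» [doc-only v2: the v1 header carried a PARAPHRASE inside «…» with wrong line numbers — withdrawn
(quote-voice rule); all declarations byte-identical]; §6, Theorem 6.4 (i) p. 114 (the arithmetic Frobenioid of Ex. 6.3 is of rationally standard type, in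
particular its Φ is non-dilating, Def. 4.5); [FrdII] Theorem 1.2 (i) p. 9 (the `p`-adic Frobenioid is of standard
type).  [cite: MochizukiFrdI2008, Def. 1.1 (i) p.19] [cite: MochizukiFrdI2008, Thm. 6.4 (i) p.114]
[cite: MochizukiFrdII2008, Thm 1.2 (i) p.9]

PROOF-ONLY file (cell abc-iut, D-0079 L-F sub-cell [FrdI/II], seat abc-iut-L1-d1 gen 5; `plan/L1/LF-FRD.tsv` pack D;
one-line bridging corollaries in the sense of RULE (a), conclusion head = the FACT declaration; 0 `def`).  Both rows
are the same PROPERTY of an endomorphism (the `PreFrobenioidData` copy and the `ElemFrobenioid`-level copy); their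
universal closures are refuted in the tree (`PreFrobenioidData.not_forall_isNonDilating`, abc-iut-f-002) — an
arbitrary endomorphism of an arbitrary monoid need not be non-dilating.  What print USES is "`Φ` is non-dilating"
for the divisor monoids of the Frobenioids at hand, i.e. the instance form «every endomorphism of `Φ(A)` induced by
an endomorphism of `A` is non-dilating» — recorded here, with `IsNonDilating` as head, at the arithmetic Frobenioids
`C_{K/F}` (abc-iut-L1-t2 lineage `arithFrobenioidOps_isNonDilatingOn`, Thm. 6.4 (i); the `ElemFrobenioid`-level
copy F-1073 at `C_{K/F}` is abc-iut-f-001's `isNonDilating_pull_arithDivisorFunctor`, p427969) and at the `p`-adic Frobenioids (abc-iut-L1-t4 lineage `PadicFrd.Datum.isNonDilatingOn`,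
`thm12_isOfStandardType_of_isOfFSMType`, [FrdII] Thm. 1.2 (i)).  Honest framing: kernel bookkeeping of OUR typed
renderings of refereed 2008 statements; nothing here bears on, or takes a side on, [IUTchIII] Cor. 3.12.
-/

namespace Literature.AlgebraicGeometry.Frobenioids

open CategoryTheory Opposite

universe v u

/-! ### F-1227 `PreFrobenioidData.IsNonDilating` -/

section Arith

variable (F : Type) [Field F] [NumberField F] (K : Type) [Field K] [Algebra F K]

/-- **F-1227 at `C_{K/F}`**: every endomorphism of `Φ(Spec L)` induced (by pull-back, in the operations of the
arithmetic Frobenioid) by an endomorphism of `Spec L` in `D = FinSubextCat F K` is non-dilating (Thm. 6.4 (i): `Φ`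
is non-dilating). [cite: MochizukiFrdI2008, Thm. 6.4 (i) p.114] -/
theorem PreFrobenioidData.isNonDilating_pull_arith (X : FinSubextCat F K) (f : X ⟶ X) :
    PreFrobenioidData.IsNonDilating ((arithFrobenioidOps F K).pull f) :=
  (arithFrobenioidOps_isNonDilatingOn F K).nonDilating X f

-- F-1073 at `C_{K/F}` (the `ElemFrobenioid`-level copy) is ALREADY in the tree: abc-iut-f-001's
-- `isNonDilating_pull_arithDivisorFunctor` (`ElementaryFrobenioidIsNonDilatingHolds.lean`, p427969) — cited, not restated.

end Arith

/-! ### The same at the `p`-adic Frobenioids ([FrdII] Ex. 1.1, Thm. 1.2 (i)) -/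

section Padic

variable {D : Type u} [Category.{v} D] {p : ℕ} [Fact p.Prime] (d : PadicFrd.Datum D p)

/-- **F-1073 at the `p`-adic Frobenioids**: every endomorphism of `Φ(A)` induced by an endomorphism of `A` is
non-dilating (abc-iut-L1-t4 lineage `PadicFrd.Datum.isNonDilatingOn`). [cite: MochizukiFrdII2008, Thm 1.2 (i) p.9] -/
theorem isNonDilating_pull_padic (A : D) (α : A ⟶ A) : IsNonDilating (pull d.Φ α) :=
  d.isNonDilatingOn A α

/-- **F-1227 at the `p`-adic Frobenioids over FSM-type bases** (in the operations `ModelFrobenioid.data` of the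
`p`-adic Frobenioid, which is of standard type, [FrdII] Thm. 1.2 (i)): every endomorphism of `Φ(A)` induced by an
endomorphism of `A` is non-dilating. [cite: MochizukiFrdII2008, Thm 1.2 (i) p.9] -/
theorem PreFrobenioidData.isNonDilating_pull_padic (hD : IsOfFSMType D) (X : D) (f : X ⟶ X) :
    PreFrobenioidData.IsNonDilating ((ModelFrobenioid.data d.Φ d.B d.divB).pull f) :=
  (d.thm12_isOfStandardType_of_isOfFSMType hD).nonDilating.nonDilating X f

end Padic

end Literature.AlgebraicGeometry.Frobenioids
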